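import Summits.CriticalPhenomena.Ising3DConformalLimit.Theorems.FKParityRobustnessIndependentStrandsJoinCrossFatteningDefs
import Summits.CriticalPhenomena.Ising3DConformalLimit.Theorems.FKParityRobustnessDepletionBoundClusters
import HarnessLib

/-!
# Crux IndependentStrandsJoin (stmt-CriticalPhenomena-14625), line `cross-fattening-decoupling` —
# stub `stub_crossFactorisation`

Route `FKParityRobustness`, sub-problem `Ising3DConformalLimit`; registered stub
`stub_crossFactorisation` of the skeleton of the line `cross-fattening-decoupling` (second-moment
method on the CROSSED clusters of two independent loop-O(1) `T`-join configurations).  The stub is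
the EXACT FIRST-MOMENT FACTORISATION `crossMoment = crossMomentK` over the vocabulary file
`Theorems/FKParityRobustnessIndependentStrandsJoinCrossFatteningDefs.lean`: on every finite graph,
for every real `t`, sources `x₁ y₁ x₂ y₂` and window `B`,

  `Σ_{F₁ ∈ 𝒯(x₁y₁)} Σ_{F₂ ∈ 𝒯(x₂y₂)} t^{|F₁|+|F₂|} N_B(F₁, F₂)
     = Σ_{K₁} Σ_{K₂} t^{|K₁|+|K₂|} Σ_{u ∈ B} A(x₁; K₁ | K₂; u) · A(x₂; K₂ | K₁; u)`,

where `𝒯(xy) = tJoins G univ {x, y}`, `Kᵢ` ranges over the source clusters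
`srcClusters G xᵢ {xᵢ, yᵢ}` (self-clustered `T`-joins of the pair), `N_B = crossCount` is the
crossed window count `#{u ∈ B : x₁ ↝_{K₁ ∪ L₂} u ∧ x₂ ↝_{K₂ ∪ L₁} u}` (`Kᵢ = cl Fᵢ xᵢ`,
`Lᵢ = soup Fᵢ xᵢ = Fᵢ ∖ Kᵢ`) and `A = attachOff` is the depleted crossed attachment mass
`A(x; K | K'; u) = Σ_{L ∈ 𝓔_∅(G − V(K'))} t^{|L|} 1[x ↝_{K ∪ L} u]`.

Proof (pure finite combinatorics, no sign condition on `t`).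

* CLUSTER–SOUP RESUMMATION of one strand (`sum_tJoins_pair_eq`): `F ↦ (K_x(F), F ∖ K_x(F))` is a
  bijection from `𝒯(xy)` onto the pairs `(K, L)` with `K ∈ srcClusters G x {x, y}` and
  `L ∈ tJoins G (offCl K x) ∅` (an even subgraph off the vertices of `K`), inverse `(K, L) ↦ K ∪ L`,
  `|F| = |K| + |L|`.  The cluster of a `T`-join of `{x, y}` is a source cluster
  (`cl_mem_srcClusters`: degrees of `F` and `K_x(F)` agree at the `F`-reachable vertices, which
  contain `x` and — a `T`-join of a pair joins its pair, `rch_of_mem_tJoins_pair` — `y`, and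
  vanish elsewhere); on each fibre the bijection is the tree's `DepletionBound.fibre_sum`
  (`S₀ = {x, y}`, `T = ∅`), transported through `tJoins_offCl_eq` (the depleted soups are the even
  subgraphs of the depleted volume) and `cl_eq` (the vocabulary's `cl` is the tree's inline filter).
* On decomposed configurations `cl (K ∪ L) x = K`, `soup (K ∪ L) x = L` (`summand_eq`), so
  `N_B(K₁ ∪ L₁, K₂ ∪ L₂) = #{u ∈ B : x₁ ↝_{K₁ ∪ L₂} u ∧ x₂ ↝_{K₂ ∪ L₁} u}`: the first event depends
  on `(K₁, L₂)` only, the second on `(K₂, L₁)` only.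
* BLOCK REGROUPING (`block_eq`): write the cardinality as `Σ_{u ∈ B} 1[·]1[·]` and swap the finite
  sums; for fixed `(K₁, K₂)` the double soup sum factorises into the product of the two attachment
  masses.

References: M. Aizenman, H. Duminil-Copin, Ann. of Math. 194 (2021), arXiv:1912.07973, Lemma 4.4 and
Prop. A.3 (second-moment template on crossed clusters) [AizenmanDuminilCopinAnnals2021];
U. T. Hansen, J. Jiang, F. R. Klausen, arXiv:2506.10765, §2 (sourced loop O(1), `T`-joins)
[HansenJiangKlausen2025]; M. Aizenman, Comm. Math. Phys. 86 (1982), §5 (conditioning on the cluster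
of a source) [AizenmanCMP1982].  Theorem-only file; helpers in the sub-namespace
`StubCrossFactorisation`.
-/

noncomputable section

open Finset SimpleGraph
open Literature.Probability.LatticeModels

namespace Summit.CriticalPhenomena.Ising3DConformalLimit.Theorems

open scoped Classical BigOperators
open Summit.CriticalPhenomena.Ising3DConformalLimit.Cruxes.IndependentStrandsJoin.CrossFatteningDecoupling

namespace StubCrossFactorisation

/-! ### The finite-sum regrouping (no graph theory) -/

/-- **Block regrouping.**  For finite index sets `S₁, S₂`, a window `B`, weights `w₁, w₂`, a constant
`c` and two families of events `P₁ L₂ u`, `P₂ L₁ u` (the first depending on the SECOND index only,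
the second on the FIRST only):
`Σ_{L₂} Σ_{L₁} c·w₁(L₁)w₂(L₂)·#{u ∈ B : P₁ L₂ u ∧ P₂ L₁ u}
   = c · Σ_{u ∈ B} (Σ_{L₂} 1[P₁ L₂ u] w₂ L₂) (Σ_{L₁} 1[P₂ L₁ u] w₁ L₁)`
(write the cardinality as a sum of indicators and swap the finite sums).  Stated for arbitrary
decidability instances, so that it applies verbatim to the unfolded vocabulary. -/
theorem block_eq {α β : Type*} (S₁ S₂ : Finset α) (B : Finset β) (c : ℝ) (w₁ w₂ : α → ℝ)
    (P₁ P₂ : α → β → Prop) (dand : ∀ L₁ L₂, DecidablePred fun u => P₁ L₂ u ∧ P₂ L₁ u)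
    (d₁ : ∀ L u, Decidable (P₁ L u)) (d₂ : ∀ L u, Decidable (P₂ L u)) :
    ∑ L₂ ∈ S₂, ∑ L₁ ∈ S₁, c * (w₁ L₁ * w₂ L₂) *
        (#(@Finset.filter β (fun u => P₁ L₂ u ∧ P₂ L₁ u) (dand L₁ L₂) B) : ℝ) =
      c * ∑ u ∈ B, (∑ L₂ ∈ S₂, @ite ℝ (P₁ L₂ u) (d₁ L₂ u) (w₂ L₂) 0) *
        (∑ L₁ ∈ S₁, @ite ℝ (P₂ L₁ u) (d₂ L₁ u) (w₁ L₁) 0) := by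
  -- the summand as a sum of indicators over the window
  have hterm : ∀ L₁ L₂, c * (w₁ L₁ * w₂ L₂) *
      (#(@Finset.filter β (fun u => P₁ L₂ u ∧ P₂ L₁ u) (dand L₁ L₂) B) : ℝ) =
      ∑ u ∈ B, c * (@ite ℝ (P₁ L₂ u) (d₁ L₂ u) (w₂ L₂) 0 * @ite ℝ (P₂ L₁ u) (d₂ L₁ u) (w₁ L₁) 0) := by
    intro L₁ L₂
    rw [Finset.natCast_card_filter, Finset.mul_sum]
    refine Finset.sum_congr rfl fun u _ => ?_
    by_cases h₁ : P₁ L₂ u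
    · by_cases h₂ : P₂ L₁ u
      · rw [if_pos ⟨h₁, h₂⟩, if_pos h₁, if_pos h₂]; ring
      · rw [if_neg (fun h => h₂ h.2), if_pos h₁, if_neg h₂]; ring
    · rw [if_neg (fun h => h₁ h.1), if_neg h₁]; ring
  have lhs : ∑ L₂ ∈ S₂, ∑ L₁ ∈ S₁, c * (w₁ L₁ * w₂ L₂) *
        (#(@Finset.filter β (fun u => P₁ L₂ u ∧ P₂ L₁ u) (dand L₁ L₂) B) : ℝ) =
      ∑ u ∈ B, ∑ L₂ ∈ S₂, ∑ L₁ ∈ S₁,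
        c * (@ite ℝ (P₁ L₂ u) (d₁ L₂ u) (w₂ L₂) 0 * @ite ℝ (P₂ L₁ u) (d₂ L₁ u) (w₁ L₁) 0) := by
    simp_rw [hterm]
    refine (Finset.sum_congr rfl fun L₂ _ => Finset.sum_comm).trans ?_
    exact Finset.sum_comm
  rw [lhs, Finset.mul_sum]
  refine Finset.sum_congr rfl fun u _ => ?_
  rw [Finset.sum_mul_sum, Finset.mul_sum]
  refine Finset.sum_congr rfl fun L₂ _ => ?_
  rw [Finset.mul_sum]

/-! ### Source clusters and depleted soups -/

variable {V : Type*} [Fintype V] [DecidableEq V] (G : SimpleGraph V) [DecidableRel G.Adj]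

/-- The vocabulary's `cl F x` is the tree's inline source-cluster filter
(`Theorems/FKParityRobustnessDepletionBoundClusters.lean`; the two differ only in the elaborated
decidability instances). -/
theorem cl_eq (F : Finset (Sym2 V)) (x : V) :
    cl F x = F.filter (fun e => ∃ v ∈ e, (fromEdgeSet (↑F : Set (Sym2 V))).Reachable x v) := by
  unfold cl rch
  congr 1

/-- A source cluster is self-clustered: `K ∈ srcClusters G x S → K_x(K) = K` (tree filter form). -/
theorem self_of_mem_srcClusters {x : V} {S : Finset V} {K : Finset (Sym2 V)}
    (hK : K ∈ srcClusters G x S) :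
    K.filter (fun e => ∃ v ∈ e, (fromEdgeSet (↑K : Set (Sym2 V))).Reachable x v) = K := by
  rw [← cl_eq]
  exact (Finset.mem_filter.1 hK).2

/-- A depleted soup avoids the vertices of the cluster (`L ⊆ E(G − V(K))`). -/
theorem avoid_of_mem_tJoins_offCl {x : V} {K L : Finset (Sym2 V)}
    (hL : L ∈ tJoins G (offCl K x) ∅) :
    ∀ e ∈ L, ∀ v ∈ e, ¬ (fromEdgeSet (↑K : Set (Sym2 V))).Reachable x v :=
  fun _ he v hv => ((mem_tJoins G).1 hL).2.1 (Finset.mem_coe.2 he) v hv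

/-- `K_x(K ∪ L) = K` for a source cluster `K` and a depleted soup `L`. -/
theorem cl_union_eq {x : V} {S : Finset V} {K L : Finset (Sym2 V)} (hK : K ∈ srcClusters G x S)
    (hL : L ∈ tJoins G (offCl K x) ∅) : cl (K ∪ L) x = K := by
  rw [cl_eq]
  exact DepletionBound.filter_cluster_union_eq (self_of_mem_srcClusters G hK)
    (avoid_of_mem_tJoins_offCl G hL)

/-- A source cluster and a depleted soup are disjoint. -/
theorem disjoint_of_mem {x : V} {S : Finset V} {K L : Finset (Sym2 V)}
    (hK : K ∈ srcClusters G x S) (hL : L ∈ tJoins G (offCl K x) ∅) : Disjoint K L :=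
  DepletionBound.disjoint_of_avoid (self_of_mem_srcClusters G hK) (avoid_of_mem_tJoins_offCl G hL)

/-- `L_x(K ∪ L) = L` for a source cluster `K` and a depleted soup `L`. -/
theorem soup_union_eq {x : V} {S : Finset V} {K L : Finset (Sym2 V)} (hK : K ∈ srcClusters G x S)
    (hL : L ∈ tJoins G (offCl K x) ∅) : soup (K ∪ L) x = L := by
  unfold soup
  rw [cl_union_eq G hK hL]
  exact Finset.union_sdiff_cancel_left (disjoint_of_mem G hK hL)

/-- `|K ∪ L| = |K| + |L|` for a source cluster `K` and a depleted soup `L`. -/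
theorem card_union_eq {x : V} {S : Finset V} {K L : Finset (Sym2 V)} (hK : K ∈ srcClusters G x S)
    (hL : L ∈ tJoins G (offCl K x) ∅) : #(K ∪ L) = #K + #L :=
  Finset.card_union_of_disjoint (disjoint_of_mem G hK hL)

/-- **A `T`-join of a pair joins its pair**: if `∂F = {x, y}` then `x ↝_F y`.  Handshake in the source
cluster (`DepletionBound.even_card_odd_degree`): otherwise the odd-degree vertices of `K_x(F)` would be
`{x}` alone, since the degrees of `F` and `K_x(F)` agree at the `F`-reachable vertices and vanish
elsewhere. -/
theorem rch_of_mem_tJoins_pair {x y : V} {F : Finset (Sym2 V)} (hF : F ∈ tJoins G Set.univ {x, y}) :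
    (fromEdgeSet (↑F : Set (Sym2 V))).Reachable x y := by
  by_contra hxy
  rw [DepletionBound.mem_tJoins_univ] at hF
  obtain ⟨hFG, hFodd⟩ := hF
  have hdiag : ∀ e ∈ F.filter (fun e => ∃ w ∈ e, (fromEdgeSet (↑F : Set (Sym2 V))).Reachable x w),
      ¬ e.IsDiag := fun e he =>
    G.not_isDiag_of_mem_edgeSet (mem_edgeFinset.1 (hFG (Finset.mem_filter.1 he).1))
  have heven := DepletionBound.even_card_odd_degree hdiag
  have hodd : (Finset.univ.filter fun v => Odd #((F.filter fun e => ∃ w ∈ e,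
      (fromEdgeSet (↑F : Set (Sym2 V))).Reachable x w).filter (v ∈ ·))) = {x} := by
    ext v
    rw [Finset.mem_filter, Finset.mem_singleton]
    by_cases hr : (fromEdgeSet (↑F : Set (Sym2 V))).Reachable x v
    · rw [DepletionBound.odd_deg_cluster_iff hr, hFodd v, Finset.mem_insert, Finset.mem_singleton]
      refine ⟨?_, fun h => ⟨Finset.mem_univ v, Or.inl h⟩⟩
      rintro ⟨-, h | rfl⟩
      · exact h
      · exact absurd hr hxy
    · rw [DepletionBound.deg_cluster_eq_zero hr]
      refine ⟨fun h => absurd h.2 Nat.not_odd_zero, ?_⟩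
      rintro rfl
      exact absurd (Reachable.refl _) hr
  rw [hodd, Finset.card_singleton] at heven
  exact Nat.not_even_one heven

/-- **The source cluster of a `T`-join of `{x, y}` is a source cluster**: `K_x(F) ⊆ F ⊆ E(G)` is
self-clustered, its degrees agree with those of `F` at the `F`-reachable vertices (which include
`x` and, a `T`-join of a pair joining its pair, `y`) and vanish elsewhere. -/
theorem cl_mem_srcClusters {x y : V} {F : Finset (Sym2 V)} (hF : F ∈ tJoins G Set.univ {x, y}) :
    cl F x ∈ srcClusters G x {x, y} := by
  have hxy : (fromEdgeSet (↑F : Set (Sym2 V))).Reachable x y := rch_of_mem_tJoins_pair G hF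
  rw [DepletionBound.mem_tJoins_univ] at hF
  obtain ⟨hFG, hFodd⟩ := hF
  unfold srcClusters
  rw [Finset.mem_filter, DepletionBound.mem_tJoins_univ]
  simp only [cl_eq]
  refine ⟨⟨(DepletionBound.filter_cluster_subset F x).trans hFG, fun v => ?_⟩,
    DepletionBound.filter_cluster_idem F x⟩
  by_cases hv : (fromEdgeSet (↑F : Set (Sym2 V))).Reachable x v
  · rw [DepletionBound.odd_deg_cluster_iff hv]
    exact hFodd v
  · rw [DepletionBound.deg_cluster_eq_zero hv, Finset.mem_insert, Finset.mem_singleton]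
    refine ⟨fun h => absurd h Nat.not_odd_zero, ?_⟩
    rintro (rfl | rfl)
    · exact absurd (Reachable.refl _) hv
    · exact absurd hxy hv

/-- The depleted soups `tJoins G (offCl K x) ∅` are the even subgraphs of the depleted volume
`Λ_K = {v : ¬ x ↝_K v}`, in the tree's `edgesIn`/`oddVerts` form. -/
theorem tJoins_offCl_eq (K : Finset (Sym2 V)) (x : V) :
    tJoins G (offCl K x) ∅ =
      (edgesIn G (Finset.univ.filter fun v =>
          ¬ (fromEdgeSet (↑K : Set (Sym2 V))).Reachable x v)).powerset.filter
        (fun R => oddVerts (Finset.univ.filter fun v =>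
          ¬ (fromEdgeSet (↑K : Set (Sym2 V))).Reachable x v) R = ∅) := by
  ext R
  rw [mem_tJoins, Finset.mem_filter, Finset.mem_powerset]
  constructor
  · rintro ⟨hRG, hRoff, hRodd⟩
    refine ⟨fun e he => ?_, ?_⟩
    · rw [mem_edgesIn_iff]
      refine ⟨mem_edgeFinset.1 (hRG he), fun v hv => ?_⟩
      exact Finset.mem_filter.2 ⟨Finset.mem_univ v, hRoff (Finset.mem_coe.2 he) v hv⟩
    · rw [oddVerts, Finset.filter_eq_empty_iff]
      intro v _ hodd
      exact Finset.notMem_empty v ((hRodd v).1 hodd)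
  · rintro ⟨hRE, hRodd⟩
    refine ⟨fun e he => mem_edgeFinset.2 (mem_edgesIn_iff.1 (hRE he)).1, fun e he v hv => ?_,
      fun v => ⟨fun hodd => ?_, fun h => absurd h (Finset.notMem_empty v)⟩⟩
    · exact (Finset.mem_filter.1 ((mem_edgesIn_iff.1 (hRE (Finset.mem_coe.1 he))).2 v hv)).2
    · by_cases hv : (fromEdgeSet (↑K : Set (Sym2 V))).Reachable x v
      · have h0 : #(R.filter (v ∈ ·)) = 0 := by
          rw [Finset.card_eq_zero, Finset.filter_eq_empty_iff]
          intro e he hve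
          exact (Finset.mem_filter.1 ((mem_edgesIn_iff.1 (hRE he)).2 v hve)).2 hv
        rw [h0] at hodd
        exact absurd hodd Nat.not_odd_zero
      · have hmem : v ∈ oddVerts (Finset.univ.filter fun v =>
            ¬ (fromEdgeSet (↑K : Set (Sym2 V))).Reachable x v) R :=
          Finset.mem_filter.2 ⟨Finset.mem_filter.2 ⟨Finset.mem_univ v, hv⟩, hodd⟩
        rw [hRodd] at hmem
        exact absurd hmem (Finset.notMem_empty v)

/-- **Fibre sum over a source cluster** (the tree's `DepletionBound.fibre_sum` with `S₀ = {x, y}`,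
`T = ∅`, in the vocabulary's notation): `F ↦ F ∖ K` is a bijection from the `T`-joins of `{x, y}`
with `K_x(F) = K` onto the depleted soups `tJoins G (offCl K x) ∅`, with inverse `L ↦ K ∪ L`. -/
theorem fibre_sum {x y : V} {K : Finset (Sym2 V)} (hK : K ∈ srcClusters G x {x, y})
    (g : Finset (Sym2 V) → ℝ) :
    ∑ F ∈ (tJoins G Set.univ {x, y}).filter (fun F => cl F x = K), g F =
      ∑ L ∈ tJoins G (offCl K x) ∅, g (K ∪ L) := by
  have hKself := self_of_mem_srcClusters G hK
  unfold srcClusters at hK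
  rw [Finset.mem_filter, DepletionBound.mem_tJoins_univ] at hK
  obtain ⟨⟨hKG, hKodd⟩, -⟩ := hK
  have h := DepletionBound.fibre_sum G hKG hKself hKodd (Finset.empty_subset _) g
  rw [Finset.union_empty] at h
  rw [tJoins_offCl_eq, ← h]
  simp only [cl_eq]

/-- **Cluster–soup resummation of one strand**:
`Σ_{F ∈ 𝒯(xy)} f(F) = Σ_{K ∈ srcClusters G x {x, y}} Σ_{L ∈ 𝓔_∅(G − V(K))} f(K ∪ L)`. -/
theorem sum_tJoins_pair_eq (x y : V) (f : Finset (Sym2 V) → ℝ) :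
    ∑ F ∈ tJoins G Set.univ {x, y}, f F =
      ∑ K ∈ srcClusters G x {x, y}, ∑ L ∈ tJoins G (offCl K x) ∅, f (K ∪ L) := by
  rw [← Finset.sum_fiberwise_of_maps_to (g := fun F => cl F x)
    (fun F (hF : F ∈ tJoins G Set.univ {x, y}) => cl_mem_srcClusters G hF) f]
  exact Finset.sum_congr rfl fun K hK => fibre_sum G hK f

/-- **The summand on a pair of decomposed configurations**: for source clusters `K₁, K₂` and depleted
soups `L₁, L₂`, `cl (Kᵢ ∪ Lᵢ) xᵢ = Kᵢ` and `soup (Kᵢ ∪ Lᵢ) xᵢ = Lᵢ`, so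
`N_B(K₁ ∪ L₁, K₂ ∪ L₂) = #{u ∈ B : x₁ ↝_{K₁ ∪ L₂} u ∧ x₂ ↝_{K₂ ∪ L₁} u}`, and
`t^{|K₁ ∪ L₁| + |K₂ ∪ L₂|} = t^{|K₁|+|K₂|} · t^{|L₁|} t^{|L₂|}` (disjoint unions). -/
theorem summand_eq {x₁ x₂ : V} {S₁ S₂ : Finset V} {K₁ K₂ L₁ L₂ : Finset (Sym2 V)}
    (hK₁ : K₁ ∈ srcClusters G x₁ S₁) (hK₂ : K₂ ∈ srcClusters G x₂ S₂)
    (hL₁ : L₁ ∈ tJoins G (offCl K₁ x₁) ∅) (hL₂ : L₂ ∈ tJoins G (offCl K₂ x₂) ∅)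
    (t : ℝ) (B : Finset V) :
    t ^ (#(K₁ ∪ L₁) + #(K₂ ∪ L₂)) * (crossCount x₁ x₂ B (K₁ ∪ L₁) (K₂ ∪ L₂) : ℝ) =
      t ^ (#K₁ + #K₂) * (t ^ #L₁ * t ^ #L₂) *
        (#(B.filter fun u => rch (K₁ ∪ L₂) x₁ u ∧ rch (K₂ ∪ L₁) x₂ u) : ℝ) := by
  unfold crossCount
  rw [cl_union_eq G hK₁ hL₁, cl_union_eq G hK₂ hL₂, soup_union_eq G hK₁ hL₁,
    soup_union_eq G hK₂ hL₂, card_union_eq G hK₁ hL₁, card_union_eq G hK₂ hL₂]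
  have hpow : t ^ (#K₁ + #L₁ + (#K₂ + #L₂)) = t ^ (#K₁ + #K₂) * (t ^ #L₁ * t ^ #L₂) := by ring
  rw [hpow]
  -- the two sides now differ only in the elaborated decidability instances of the filter
  congr 4

end StubCrossFactorisation

/-- **Registered stub `stub_crossFactorisation` of the line `cross-fattening-decoupling`** (crux
stmt-CriticalPhenomena-14625): the exact first-moment factorisation `crossMoment = crossMomentK`,
`Σ_{F₁,F₂} t^{|F₁|+|F₂|} N_B(F₁,F₂) = Σ_{K₁,K₂} t^{|K₁|+|K₂|} Σ_{u∈B} A(x₁;K₁|K₂;u) A(x₂;K₂|K₁;u)`,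
on every finite graph and for every real `t`.  Resum each strand over its source cluster and
depleted soup (`StubCrossFactorisation.sum_tJoins_pair_eq`, twice, with one `Finset.sum_comm` in
between), identify the crossed count on decomposed configurations
(`StubCrossFactorisation.summand_eq`) and regroup the window indicators
(`StubCrossFactorisation.block_eq`). -/
theorem stub_crossFactorisation :
    ∀ (V : Type) [Fintype V] [DecidableEq V] (G : SimpleGraph V) [DecidableRel G.Adj] (t : ℝ)
      (x₁ y₁ x₂ y₂ : V) (B : Finset V),
      crossMoment G t x₁ y₁ x₂ y₂ B = crossMomentK G t x₁ y₁ x₂ y₂ B := by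
  intro V _ _ G _ t x₁ y₁ x₂ y₂ B
  unfold crossMoment crossMomentK
  rw [StubCrossFactorisation.sum_tJoins_pair_eq G x₁ y₁]
  refine Finset.sum_congr rfl fun K₁ hK₁ => ?_
  conv_lhs => rw [Finset.sum_comm]
  rw [StubCrossFactorisation.sum_tJoins_pair_eq G x₂ y₂]
  refine Finset.sum_congr rfl fun K₂ hK₂ => ?_
  rw [Finset.sum_congr rfl fun L₂ hL₂ => Finset.sum_congr rfl fun L₁ hL₁ =>
    StubCrossFactorisation.summand_eq G hK₁ hK₂ hL₁ hL₂ t B]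
  unfold attachOff
  exact StubCrossFactorisation.block_eq _ _ B _ (fun L => t ^ #L) (fun L => t ^ #L)
    (fun L u => rch (K₁ ∪ L) x₁ u) (fun L u => rch (K₂ ∪ L) x₂ u) _ _ _

end Summit.CriticalPhenomena.Ising3DConformalLimit.Theorems

end
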